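import Summits.BirchSwinnertonDyer.BirchSwinnertonDyer.Theorems.SignedLowerHalvesSmallImageLowerHalfBothSignsRttD2TwistAssembly
import HarnessLib

/-!
# Route `SignedLowerHalves`, crux L `SmallImageLowerHalfBothSigns` (stmt-BirchSwinnertonDyer-23599), line `rtt_w3` v14 — E2, row «D-tw-coh» part 2c(iv):
# FULL semilinearity of the assembled twist — `Tw (F • x) = σ(F) • Tw x` for EVERY `F ∈ Λ_{𝒪,2}`, given `σ` on the three generators

INPUTS hand `bsd-inputs-honda-p1` g23 (LEAD g11 RULING «U» (U5); the LEAD's binder `he₁ he₂ : ∀ r m, e (r • m) = σ r • e m`). For ANY ring endomorphism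
`σ` of `Λ_{𝒪,2} = 𝒪⟦T₂⟧⟦T₁⟧` fixing the constants and with `σ(T_i) = u_i(1 + T_i) − 1`, `u_i = θ(γ_i)θ'(γ_i)⁻¹` (the twist `Tw_η`; its EXISTENCE as a ring map —
analytic, needs `𝒪` complete — is row «D-tw-alg», not asserted here), the assembled twist of part 2c(ii) satisfies `Tw (F • x) = σ F • Tw x` for all power series `F`:
* §1 the set of such `F` is a subsemiring containing `C (C c)`, `T₁`, `T₂` (parts 2c(ii): `twistHom_C_C_smul`, `twistHom_X_smul`, `twistHom_C_X_smul`), hence every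
  "polynomial";
* §2 CONTINUITY: modulo the ideal `(T₁^N, T₂^N)` every `F` is such a polynomial (double truncation), and for `N ≫ 0` (depending on the level `(n,k)` and on
  `x`) both `Tw ((T₁^N, T₂^N) • x)` and `σ(T₁^N, T₂^N) • Tw x` die at level `(n,k)`: `T_i` acts on the layer as the locally nilpotent `conj_{γ_i} − 1` ((P5)/(P6),
  tree `isLocNil₂_layerConjEndO`, `i ≤ 2`), `σ(T_i)` as `u_i·conj'_{γ_i} − 1 = tw ∘ (conj_{γ_i} − 1) ∘ tw⁻¹` (parts 2b, 1b(i)), and the level kernels are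
  `Λ_{𝒪,2}`-submodules ((P8)); cofinal injectivity (part 2c(i)) concludes.
* ★★★ `twistHom_smul` / `twistEquiv_smul` — the statements.
THEOREMS + one `abbrev` (`layerScalarConjEndO`, the operator `u·conj_γ` in `AddMonoid.End`); no named fact, no `sorry`; crux L, crux M, E2 and BSD remain OPEN and are
proved for NO curve by any of this.
References: [Rubin2000] Ch. VI §6.1–6.2; [JohnsonLeungKings2011] §4.1–§4.2; [Lang1990] Ch. 5 §1.
-/

set_option autoImplicit false
-- the Theorems namespace of this sub repeats the summit name by design (D-0017 nested layout)
set_option linter.dupNamespace false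

noncomputable section

open scoped NumberField
open CategoryTheory Field IsDedekindDomain
open Literature.NumberTheory.GaloisRepresentations
open Literature.NumberTheory.EllipticCurves
open Literature.NumberTheory.ComplexMultiplication.EllipticUnits
open Literature.NumberTheory.ComplexMultiplication.EllipticUnits.JohnsonLeungKings2011

namespace Summit.BirchSwinnertonDyer.BirchSwinnertonDyer.Theorems.SmallImageRttD2Twist

/-! ## §0 Double truncation in `A⟦T₂⟧⟦T₁⟧` -/

section Trunc

variable {A : Type} [CommRing A]

/-- `X^N` divides a power series minus its truncation `Σ_{j<N} C(a_j) X^j`. [folklore] -/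
theorem X_pow_dvd_sub_sum_range (N : ℕ) (φ : PowerSeries A) :
    (PowerSeries.X : PowerSeries A) ^ N ∣ φ - ∑ j ∈ Finset.range N, PowerSeries.C (PowerSeries.coeff j φ) * PowerSeries.X ^ j := by
  rw [PowerSeries.X_pow_dvd_iff]
  intro m hm
  rw [map_sub, map_sum, sub_eq_zero]
  simp_rw [PowerSeries.coeff_C_mul_X_pow]
  rw [Finset.sum_ite_eq, if_pos (Finset.mem_range.mpr hm)]

/-- **Double truncation**: modulo the ideal `(T₁^N, T₂^N)` every `F ∈ A⟦T₂⟧⟦T₁⟧` lies in the subsemiring generated by the constants `C (C a)` and `T₁ = X`, `T₂ = C X`.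
[folklore] -/
theorem exists_mem_subsemiring_sub_mem_span (M : Subsemiring (PowerSeries (PowerSeries A)))
    (hC : ∀ a : A, PowerSeries.C (PowerSeries.C a) ∈ M) (hX : (PowerSeries.X : PowerSeries (PowerSeries A)) ∈ M)
    (hCX : PowerSeries.C (PowerSeries.X : PowerSeries A) ∈ M) (N : ℕ) (F : PowerSeries (PowerSeries A)) :
    ∃ P ∈ M, F - P ∈ Ideal.span {(PowerSeries.X : PowerSeries (PowerSeries A)) ^ N, PowerSeries.C (PowerSeries.X : PowerSeries A) ^ N} := by
  classical
  -- inner truncations of the coefficients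
  set a : ℕ → PowerSeries A := fun j ↦ PowerSeries.coeff j F with ha
  set P : PowerSeries (PowerSeries A) := ∑ j ∈ Finset.range N,
    PowerSeries.C (∑ i ∈ Finset.range N, PowerSeries.C (PowerSeries.coeff i (a j)) * PowerSeries.X ^ i) * PowerSeries.X ^ j with hP
  refine ⟨P, ?_, ?_⟩
  · refine Subsemiring.sum_mem _ fun j _ ↦ Subsemiring.mul_mem _ ?_ (Subsemiring.pow_mem _ hX j)
    rw [map_sum]
    refine Subsemiring.sum_mem _ fun i _ ↦ ?_
    rw [map_mul, map_pow]
    exact Subsemiring.mul_mem _ (hC _) (Subsemiring.pow_mem _ hCX i)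
  · -- `F − P = (F − P₀) + (P₀ − P)`, `P₀` the outer truncation
    obtain ⟨G₁, hG₁⟩ := X_pow_dvd_sub_sum_range N F
    have hinner : ∀ j, ∃ b : PowerSeries A,
        a j - ∑ i ∈ Finset.range N, PowerSeries.C (PowerSeries.coeff i (a j)) * PowerSeries.X ^ i = PowerSeries.X ^ N * b :=
      fun j ↦ X_pow_dvd_sub_sum_range N (a j)
    choose b hb using hinner
    have hdecomp : F - P = PowerSeries.X ^ N * G₁ +
        PowerSeries.C (PowerSeries.X : PowerSeries A) ^ N * ∑ j ∈ Finset.range N, PowerSeries.C (b j) * PowerSeries.X ^ j := by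
      have h0 : F = ∑ j ∈ Finset.range N, PowerSeries.C (a j) * PowerSeries.X ^ j + PowerSeries.X ^ N * G₁ := by
        rw [← hG₁]; abel
      have h1 : ∀ j ∈ Finset.range N, PowerSeries.C (a j) * PowerSeries.X ^ j =
          PowerSeries.C (∑ i ∈ Finset.range N, PowerSeries.C (PowerSeries.coeff i (a j)) * PowerSeries.X ^ i) * PowerSeries.X ^ j +
            PowerSeries.C (PowerSeries.X : PowerSeries A) ^ N * (PowerSeries.C (b j) * PowerSeries.X ^ j) := by
        intro j _
        rw [← map_pow, ← mul_assoc, ← map_mul, ← hb j, ← add_mul, ← map_add, add_sub_cancel]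
      rw [hP, Finset.mul_sum, h0, Finset.sum_congr rfl h1, Finset.sum_add_distrib]
      abel
    rw [hdecomp]
    exact Ideal.add_mem _ (Ideal.mul_mem_right _ _ (Ideal.subset_span (by simp)))
      (Ideal.mul_mem_right _ _ (Ideal.subset_span (by simp)))

end Trunc

/-! ## §1–§2 Semilinearity of the assembled twist -/

section Semilinear

variable {K : Type} [Field K] [NumberField K] {p : ℕ} [Fact p.Prime] (S : Set (PadicAlgCl p))
  (κ₁ κ₂ : ZpExtension K p) {γ₁ γ₂ : absoluteGaloisGroup K} (θ θ' : absoluteGaloisGroup K →ₜ* (padicCoeffIntegers S)ˣ)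
  (𝔣 : Ideal (𝓞 K)) {i : ℕ} (hi : i ≤ 2) (m : ℕ → ℕ) (hmono : Monotone m)
  (hN : ∀ k, ∀ σ ∈ ramificationSubgroup K (suppPF p 𝔣), ∃ b : padicCoeffIntegers S,
    ((θ' σ : (padicCoeffIntegers S)ˣ) : padicCoeffIntegers S) = (θ σ : (padicCoeffIntegers S)ˣ) + ((p : padicCoeffIntegers S)) ^ k * b)
  (hm : ∀ k, ∀ σ ∈ JohnsonLeungKings2011.pairLayerSubgroup κ₁ κ₂ (m k), ∃ b : padicCoeffIntegers S,
    ((θ' σ : (padicCoeffIntegers S)ˣ) : padicCoeffIntegers S) = (θ σ : (padicCoeffIntegers S)ˣ) + ((p : padicCoeffIntegers S)) ^ k * b)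
  (D : IwasawaCohomologyDataO S κ₁ κ₂ γ₁ γ₂ θ 𝔣 i) (D' : IwasawaCohomologyDataO S κ₁ κ₂ γ₁ γ₂ θ' 𝔣 i)
  (σ : IwasawaAlgebraO₂ S →+* IwasawaAlgebraO₂ S)
  (hσC : ∀ c : padicCoeffIntegers S,
    σ (PowerSeries.C (PowerSeries.C c : PowerSeries (padicCoeffIntegers S))) = PowerSeries.C (PowerSeries.C c : PowerSeries (padicCoeffIntegers S)))
  (hσX : σ PowerSeries.X =
    (PowerSeries.C (PowerSeries.C (((θ γ₁ * (θ' γ₁)⁻¹ : (padicCoeffIntegers S)ˣ)) : padicCoeffIntegers S) :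
        PowerSeries (padicCoeffIntegers S)) : IwasawaAlgebraO₂ S) * (1 + PowerSeries.X) - 1)
  (hσCX : σ (PowerSeries.C (PowerSeries.X : PowerSeries (padicCoeffIntegers S))) =
    (PowerSeries.C (PowerSeries.C (((θ γ₂ * (θ' γ₂)⁻¹ : (padicCoeffIntegers S)ˣ)) : padicCoeffIntegers S) :
        PowerSeries (padicCoeffIntegers S)) : IwasawaAlgebraO₂ S) *
      (1 + (PowerSeries.C (PowerSeries.X : PowerSeries (padicCoeffIntegers S)) : IwasawaAlgebraO₂ S)) - 1)

/-! ### The operators `conj_γ − 1` on the layers of `D` and `u·conj'_γ − 1` on those of `D'` -/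

/-- The operator `u·conj_γ` on a layer group, in `AddMonoid.End` (so that its powers make sense). [cite: Rubin2000, Ch. VI §6.1–6.2] -/
abbrev layerScalarConjEndO (ϑ : absoluteGaloisGroup K →ₜ* (padicCoeffIntegers S)ˣ) (n k i : ℕ) (u : padicCoeffIntegers S)
    (γ : absoluteGaloisGroup K) : AddMonoid.End (layerCohO S κ₁ κ₂ ϑ 𝔣 n k i) :=
  (layerScalarO S κ₁ κ₂ ϑ 𝔣 n k i u).comp (layerConjO S κ₁ κ₂ ϑ 𝔣 n k i γ)

omit [NumberField K] in
/-- `(u·conj_γ − 1) w = u·(γ·w) − w`. [folklore] -/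
theorem layerScalarConjEndO_sub_one_apply (ϑ : absoluteGaloisGroup K →ₜ* (padicCoeffIntegers S)ˣ) (n k : ℕ) (u : padicCoeffIntegers S)
    (γ : absoluteGaloisGroup K) (w : layerCohO S κ₁ κ₂ ϑ 𝔣 n k i) :
    (layerScalarConjEndO S κ₁ κ₂ 𝔣 ϑ n k i u γ - 1) w = layerScalarO S κ₁ κ₂ ϑ 𝔣 n k i u (layerConjO S κ₁ κ₂ ϑ 𝔣 n k i γ w) - w := rfl

omit [NumberField K] in
/-- `(conj_γ − 1) w = γ·w − w` in `AddMonoid.End`. [folklore] -/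
theorem layerConjEndO_sub_one_apply (ϑ : absoluteGaloisGroup K →ₜ* (padicCoeffIntegers S)ˣ) (n k : ℕ) (γ : absoluteGaloisGroup K)
    (w : layerCohO S κ₁ κ₂ ϑ 𝔣 n k i) :
    (layerConjEndO S κ₁ κ₂ ϑ 𝔣 n k i γ - 1) w = layerConjO S κ₁ κ₂ ϑ 𝔣 n k i γ w - w := rfl

/-- (P5) iterated: `proj (T₁^N • y) = (conj_{γ₁} − 1)^N (proj y)`. [cite: JohnsonLeungKings2011, §4.2 (arXiv p0012:L109–112)] -/
theorem proj_X_pow_smul (n k N : ℕ) (y : D.H) :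
    D.proj n k ((PowerSeries.X : IwasawaAlgebraO₂ S) ^ N • y) = ((layerConjEndO S κ₁ κ₂ θ 𝔣 n k i γ₁ - 1) ^ N) (D.proj n k y) := by
  induction N with
  | zero => rw [pow_zero, one_smul, pow_zero, AddMonoid.End.one_apply]
  | succ N ih =>
    rw [pow_succ', mul_smul, D.proj_T₁_smul, ih, pow_succ', AddMonoid.End.coe_mul, Function.comp_apply,
      layerConjEndO_sub_one_apply]

/-- (P6) iterated: `proj (T₂^N • y) = (conj_{γ₂} − 1)^N (proj y)`. [cite: JohnsonLeungKings2011, §4.2 (arXiv p0012:L109–112)] -/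
theorem proj_C_X_pow_smul (n k N : ℕ) (y : D.H) :
    D.proj n k ((PowerSeries.C (PowerSeries.X : PowerSeries (padicCoeffIntegers S)) : IwasawaAlgebraO₂ S) ^ N • y) =
      ((layerConjEndO S κ₁ κ₂ θ 𝔣 n k i γ₂ - 1) ^ N) (D.proj n k y) := by
  induction N with
  | zero => rw [pow_zero, one_smul, pow_zero, AddMonoid.End.one_apply]
  | succ N ih =>
    rw [pow_succ', mul_smul, D.proj_T₂_smul, ih, pow_succ', AddMonoid.End.coe_mul, Function.comp_apply,
      layerConjEndO_sub_one_apply]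

include hσX in
/-- `σ(T₁)` acts on the level `(n,k)` of `D'` as `u₁·conj'_{γ₁} − 1` ((P5), (P7)). [cite: Rubin2000, Ch. VI §6.1–6.2] -/
theorem proj_sigma_X_smul (n k : ℕ) (y : D'.H) :
    D'.proj n k (σ PowerSeries.X • y) =
      (layerScalarConjEndO S κ₁ κ₂ 𝔣 θ' n k i (((θ γ₁ * (θ' γ₁)⁻¹ : (padicCoeffIntegers S)ˣ)) : padicCoeffIntegers S) γ₁ - 1)
        (D'.proj n k y) := by
  rw [hσX, sub_smul, one_smul, map_sub, mul_smul, D'.proj_C_smul, add_smul, one_smul, map_add, D'.proj_T₁_smul,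
    add_sub_cancel]
  rfl

include hσCX in
/-- `σ(T₂)` acts on the level `(n,k)` of `D'` as `u₂·conj'_{γ₂} − 1` ((P6), (P7)). [cite: Rubin2000, Ch. VI §6.1–6.2] -/
theorem proj_sigma_C_X_smul (n k : ℕ) (y : D'.H) :
    D'.proj n k (σ (PowerSeries.C (PowerSeries.X : PowerSeries (padicCoeffIntegers S))) • y) =
      (layerScalarConjEndO S κ₁ κ₂ 𝔣 θ' n k i (((θ γ₂ * (θ' γ₂)⁻¹ : (padicCoeffIntegers S)ˣ)) : padicCoeffIntegers S) γ₂ - 1)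
        (D'.proj n k y) := by
  rw [hσCX, sub_smul, one_smul, map_sub, mul_smul, D'.proj_C_smul, add_smul, one_smul, map_add, D'.proj_T₂_smul,
    add_sub_cancel]
  rfl

/-- Iteration of an `AddMonoid.End` read through `proj`: if `proj (g • y) = E (proj y)` for all `y` then `proj (g^N • y) = E^N (proj y)`. [folklore] -/
theorem proj_pow_smul_of (ϑ : absoluteGaloisGroup K →ₜ* (padicCoeffIntegers S)ˣ) {γ₁' γ₂' : absoluteGaloisGroup K}
    (I : IwasawaCohomologyDataO S κ₁ κ₂ γ₁' γ₂' ϑ 𝔣 i) (n k : ℕ) (g : IwasawaAlgebraO₂ S) (E : AddMonoid.End (layerCohO S κ₁ κ₂ ϑ 𝔣 n k i))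
    (hg : ∀ y, I.proj n k (g • y) = E (I.proj n k y)) (N : ℕ) (y : I.H) :
    I.proj n k (g ^ N • y) = (E ^ N) (I.proj n k y) := by
  induction N with
  | zero => rw [pow_zero, one_smul, pow_zero, AddMonoid.End.one_apply]
  | succ N ih => rw [pow_succ', mul_smul, hg, ih, pow_succ', AddMonoid.End.coe_mul, Function.comp_apply]

omit [NumberField K] in
include hN hm in
/-- **The layer twist conjugates `conj_γ − 1` into `u·conj'_γ − 1`** (part 2b, iterated): `(u·conj' − 1)^N (tw w) = tw ((conj − 1)^N w)`.
[cite: Rubin2000, Ch. VI §6.1–6.2] -/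
theorem twistedEnd_pow_layerTwistO {n k : ℕ} (hn : m k ≤ n) (γ : absoluteGaloisGroup K) (N : ℕ) (w : layerCohO S κ₁ κ₂ θ 𝔣 n k i) :
    ((layerScalarConjEndO S κ₁ κ₂ 𝔣 θ' n k i (((θ γ * (θ' γ)⁻¹ : (padicCoeffIntegers S)ˣ)) : padicCoeffIntegers S) γ - 1) ^ N)
        (layerTwistO S κ₁ κ₂ θ θ' 𝔣 m hN hm n k i hn w) =
      layerTwistO S κ₁ κ₂ θ θ' 𝔣 m hN hm n k i hn (((layerConjEndO S κ₁ κ₂ θ 𝔣 n k i γ - 1) ^ N) w) := by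
  induction N generalizing w with
  | zero => rw [pow_zero, pow_zero, AddMonoid.End.one_apply, AddMonoid.End.one_apply]
  | succ N ih =>
    rw [pow_succ, AddMonoid.End.coe_mul, Function.comp_apply, pow_succ, AddMonoid.End.coe_mul, Function.comp_apply, ← ih,
      layerConjEndO_sub_one_apply, map_sub, layerTwistO_layerConjO, layerScalarConjEndO_sub_one_apply]

/-! ### The statement -/

include hi hσC hσX hσCX in
/-- ★★★ **FULL SEMILINEARITY of the assembled twist**: for every ring endomorphism `σ` of `Λ_{𝒪,2}` fixing the constants with `σ(T_i) = u_i(1 + T_i) − 1`,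
`u_i = θ(γ_i)θ'(γ_i)⁻¹`, and every `F ∈ Λ_{𝒪,2}`: `Tw (F • x) = σ F • Tw x` (`i ≤ 2`). [cite: Rubin2000, Ch. VI §6.1–6.2] [cite: JohnsonLeungKings2011, §4.1–§4.2 (arXiv p0012:L39–112)] -/
theorem twistHom_smul (F : IwasawaAlgebraO₂ S) (x : D.H) :
    twistHom S κ₁ κ₂ θ θ' 𝔣 m hmono hN hm D D' (F • x) = σ F • twistHom S κ₁ κ₂ θ θ' 𝔣 m hmono hN hm D D' x := by
  -- §1 the good subsemiring
  let M : Subsemiring (IwasawaAlgebraO₂ S) :=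
    { carrier := {G | ∀ y : D.H, twistHom S κ₁ κ₂ θ θ' 𝔣 m hmono hN hm D D' (G • y) = σ G • twistHom S κ₁ κ₂ θ θ' 𝔣 m hmono hN hm D D' y}
      mul_mem' := fun {G H} hG hH y ↦ by
        simp only [Set.mem_setOf_eq] at hG hH ⊢
        rw [mul_smul, hG, hH, map_mul, mul_smul]
      one_mem' := fun y ↦ by rw [one_smul, map_one, one_smul]
      add_mem' := fun {G H} hG hH y ↦ by
        simp only [Set.mem_setOf_eq] at hG hH ⊢
        rw [add_smul, map_add, hG, hH, map_add, add_smul]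
      zero_mem' := fun y ↦ by rw [zero_smul, map_zero, map_zero, zero_smul] }
  have hMC : ∀ c : padicCoeffIntegers S, PowerSeries.C (PowerSeries.C c : PowerSeries (padicCoeffIntegers S)) ∈ M := fun c y ↦ by
    show twistHom S κ₁ κ₂ θ θ' 𝔣 m hmono hN hm D D' (_ • y) = σ _ • _
    rw [hσC, twistHom_C_C_smul]
  have hMX : (PowerSeries.X : IwasawaAlgebraO₂ S) ∈ M := fun y ↦ by
    show twistHom S κ₁ κ₂ θ θ' 𝔣 m hmono hN hm D D' (_ • y) = σ _ • _
    rw [hσX, twistHom_X_smul]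
  have hMCX : PowerSeries.C (PowerSeries.X : PowerSeries (padicCoeffIntegers S)) ∈ M := fun y ↦ by
    show twistHom S κ₁ κ₂ θ θ' 𝔣 m hmono hN hm D D' (_ • y) = σ _ • _
    rw [hσCX, twistHom_C_X_smul]
  -- §2 continuity: compare at each cofinal level
  refine sub_eq_zero.mp (eq_zero_of_proj_eq_zero_of_le D' m _ fun k n hn ↦ ?_)
  -- nilpotence indices at `c := proj_{n,k} x`
  obtain ⟨N₁, hN₁⟩ := (isLocNil₂_layerConjEndO S κ₁ κ₂ γ₁ γ₂ θ 𝔣 n k hi).nil₁ (D.proj n k x)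
  obtain ⟨N₂, hN₂⟩ := (isLocNil₂_layerConjEndO S κ₁ κ₂ γ₁ γ₂ θ 𝔣 n k hi).nil₂ (D.proj n k x)
  have hkill₁ : ((layerConjEndO S κ₁ κ₂ θ 𝔣 n k i γ₁ - 1) ^ (N₁ + N₂)) (D.proj n k x) = 0 := by
    rw [add_comm, pow_add, AddMonoid.End.coe_mul, Function.comp_apply, hN₁, map_zero]
  have hkill₂ : ((layerConjEndO S κ₁ κ₂ θ 𝔣 n k i γ₂ - 1) ^ (N₁ + N₂)) (D.proj n k x) = 0 := by
    rw [pow_add, AddMonoid.End.coe_mul, Function.comp_apply, hN₂, map_zero]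
  set N := N₁ + N₂ with hNdef
  -- decompose `F = P + j`, `P ∈ M`, `j ∈ (T₁^N, T₂^N)`
  obtain ⟨P, hPM, hj⟩ := exists_mem_subsemiring_sub_mem_span M hMC hMX hMCX N F
  obtain ⟨a, b, hab⟩ := Ideal.mem_span_pair.mp hj
  have hF : F = P + (a * PowerSeries.X ^ N + b * PowerSeries.C (PowerSeries.X : PowerSeries (padicCoeffIntegers S)) ^ N) := by
    rw [hab, add_sub_cancel]
  -- the `(T₁^N, T₂^N)`-part dies at level `(n,k)` on the `D`-side …
  have hz₁ : D.proj n k ((PowerSeries.X : IwasawaAlgebraO₂ S) ^ N • x) = 0 := by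
    rw [proj_X_pow_smul S κ₁ κ₂ θ 𝔣 D, hkill₁]
  have hz₂ : D.proj n k ((PowerSeries.C (PowerSeries.X : PowerSeries (padicCoeffIntegers S)) : IwasawaAlgebraO₂ S) ^ N • x) = 0 := by
    rw [proj_C_X_pow_smul S κ₁ κ₂ θ 𝔣 D, hkill₂]
  have hD : D.proj n k ((a * PowerSeries.X ^ N + b * PowerSeries.C (PowerSeries.X : PowerSeries (padicCoeffIntegers S)) ^ N) • x) = 0 := by
    rw [add_smul, map_add, mul_smul, mul_smul, D.proj_smul_eq_zero n k a _ hz₁, D.proj_smul_eq_zero n k b _ hz₂, add_zero]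
  -- … and on the `D'`-side after `σ`
  have hz₁' : D'.proj n k (σ PowerSeries.X ^ N • twistHom S κ₁ κ₂ θ θ' 𝔣 m hmono hN hm D D' x) = 0 := by
    rw [proj_pow_smul_of S κ₁ κ₂ 𝔣 θ' D' n k (σ PowerSeries.X) _ (proj_sigma_X_smul S κ₁ κ₂ θ θ' 𝔣 D' σ hσX n k) N,
      proj_twistHom S κ₁ κ₂ θ θ' 𝔣 m hmono hN hm D D' hn, twistedEnd_pow_layerTwistO S κ₁ κ₂ θ θ' 𝔣 m hN hm hn, hkill₁, map_zero]
  have hz₂' : D'.proj n k (σ (PowerSeries.C (PowerSeries.X : PowerSeries (padicCoeffIntegers S))) ^ N •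
      twistHom S κ₁ κ₂ θ θ' 𝔣 m hmono hN hm D D' x) = 0 := by
    rw [proj_pow_smul_of S κ₁ κ₂ 𝔣 θ' D' n k _ _ (proj_sigma_C_X_smul S κ₁ κ₂ θ θ' 𝔣 D' σ hσCX n k) N,
      proj_twistHom S κ₁ κ₂ θ θ' 𝔣 m hmono hN hm D D' hn, twistedEnd_pow_layerTwistO S κ₁ κ₂ θ θ' 𝔣 m hN hm hn, hkill₂, map_zero]
  have hD' : D'.proj n k (σ (a * PowerSeries.X ^ N + b * PowerSeries.C (PowerSeries.X : PowerSeries (padicCoeffIntegers S)) ^ N) •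
      twistHom S κ₁ κ₂ θ θ' 𝔣 m hmono hN hm D D' x) = 0 := by
    rw [map_add, map_mul, map_mul, map_pow, map_pow, add_smul, map_add, mul_smul, mul_smul,
      D'.proj_smul_eq_zero n k (σ a) _ hz₁', D'.proj_smul_eq_zero n k (σ b) _ hz₂', add_zero]
  -- assemble
  have e1 : twistHom S κ₁ κ₂ θ θ' 𝔣 m hmono hN hm D D' (F • x) =
      σ P • twistHom S κ₁ κ₂ θ θ' 𝔣 m hmono hN hm D D' x +
        twistHom S κ₁ κ₂ θ θ' 𝔣 m hmono hN hm D D'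
          ((a * PowerSeries.X ^ N + b * PowerSeries.C (PowerSeries.X : PowerSeries (padicCoeffIntegers S)) ^ N) • x) := by
    rw [hF, add_smul, map_add, hPM x]
  have e2 : σ F • twistHom S κ₁ κ₂ θ θ' 𝔣 m hmono hN hm D D' x =
      σ P • twistHom S κ₁ κ₂ θ θ' 𝔣 m hmono hN hm D D' x +
        σ (a * PowerSeries.X ^ N + b * PowerSeries.C (PowerSeries.X : PowerSeries (padicCoeffIntegers S)) ^ N) •
          twistHom S κ₁ κ₂ θ θ' 𝔣 m hmono hN hm D D' x := by
    rw [hF, map_add, add_smul]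
  -- `Tw (j • x)` has level component `tw (proj (j • x)) = tw 0 = 0`, and `σ j • Tw x` dies too
  rw [map_sub, e1, e2, map_add, map_add, hD', proj_twistHom S κ₁ κ₂ θ θ' 𝔣 m hmono hN hm D D' hn, hD, map_zero, add_zero, sub_self]

include hi hσC hσX hσCX in
/-- ★★★ The same for the isomorphism `twistEquiv`. [cite: Rubin2000, Ch. VI §6.1–6.2] -/
theorem twistEquiv_smul (F : IwasawaAlgebraO₂ S) (x : D.H) :
    twistEquiv S κ₁ κ₂ θ θ' 𝔣 m hmono hN hm D D' (F • x) = σ F • twistEquiv S κ₁ κ₂ θ θ' 𝔣 m hmono hN hm D D' x :=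
  twistHom_smul S κ₁ κ₂ θ θ' 𝔣 hi m hmono hN hm D D' σ hσC hσX hσCX F x

end Semilinear

end Summit.BirchSwinnertonDyer.BirchSwinnertonDyer.Theorems.SmallImageRttD2Twist

end
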